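import Mathlib
import Literature.Analysis.FluidPDE.Tao2016AveragedNS.ShiftSetCascadeFlows
import Summits.NavierStokesRegularity.NavierStokesRegularity.Theorems.TaoLadderRungTwoFlatCertificateGlueCheckerFrameOn
import Summits.NavierStokesRegularity.NavierStokesRegularity.Theorems.TaoLadderRungTwoFlatCertificateGlueCheckerScalarOn
import Summits.NavierStokesRegularity.NavierStokesRegularity.Theorems.TaoLadderRungTwoFlatCertificateGlueCheckerStepOn
import HarnessLib

/-!
# Certificate glue on a shift set `𝕊`, XXV-j: THE CHECKER'S VECTOR-LAYOUT CLAUSES — Boolean tests and computed dyadic bounds for the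
  vector-remainder mean-value Lohner step of glue XIX-h `stepCert_of_plohner_mv` (helper for items stmt-NavierStokesRegularity-22987
  `FlatGapCertificatesV2` (crux K_A♭ of route TaoLadderRungTwoFlat) and stmt-24295 K_A₂(64); cell harvest/h2-tao-ladder, p1 g16;
  theory-1 A-73 / A-75 (NUM-T41m F-19/F-20, NUM-T41o F-30, A75-NOTE))

* `checkRowsLe` / `mulVec_le_of_checkRowsLe` — PER-ROW sums `Σ_d |A c d|·r_d ≤ s_c` (frame radii `ρ_c` of `C` (C3v) and the
  transport rows `|T ξ| ≤ r'` (C6v));  `checkHull` / `hull_le_of_checkHull` — `ρ_c + E_c ≤ ρ_s`;  `checkGuardV` — `0 ≤ h`,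
  `b (m_C + ρ_s) h < 1`;
* `hullBoxA`, `symBoxA` (+ `mem_*`) — the node hull box `[x_c − ρ_c − E_c, x_c + ρ_c + E_c]` and the remainder box `[−E_c, E_c]`
  as interval arrays (base box / direction box of the substrate's jet tables);
* `dPArr` / `abs_TPoly_sub_le_dPArr` (C4v, computed), `nveArr` / `abs_VPoly_le_nveArr` (the remainder-direction bound `NVE_c`:
  ONE variational column over the hull box with direction box `[−E, E]`), `kEntry`, `kappaArr` / `kappa_of_kappaArr` (the frame
  enclosure `κ_c = Σ_j mag((Cn·T)_{cj} ⊖ [V C]_{cj})·r_j` with `[V C]` = `vcolsA` over the HULL box);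
* `checkERecV` / `eRecV_of_check` — the per-component E-recursion `dP_c + κ_c + NVE_c + Rem ≤ E'_c`, `Rem = remQ p b (m_C+ρ_s) h`;
(The product table and the product-form cover test C13v are glue XXV-k `…CheckerCoverOn`.)

HONEST FRAMING: Tao-type MODEL lattices (Tao 2016 §4/§6 vocabulary, shift-set parametrised); arithmetic soundness lemmas — no certificate data,
nothing certified, no stub closed, nothing about the Navier–Stokes equations.
-/

-- the sub-problem namespace repeats the summit name by design (D-0017)
set_option linter.dupNamespace false

namespace Summit.NavierStokesRegularity.NavierStokesRegularity.Theorems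

open Set Finset Literature.Analysis.FluidPDE Literature.Analysis.FluidPDE.TaoCascade
open Summit.NavierStokesRegularity.NavierStokesRegularity.Theorems.TaylorModelCert
open Summit.NavierStokesRegularity.NavierStokesRegularity.Theorems.TaylorModelReadout

namespace CertificateGlueOn

/-! ### Per-row tests on dyadic data -/

/-- **Per-row sums**: `Σ_{d<n} |A c d| · r_d ≤ s_c` for every row `c < n`. [folklore] -/
def checkRowsLe (n : ℕ) (A : Array (Array Dyad)) (r s : Array Dyad) : Bool :=
  (List.range n).all fun c => Dyad.ble (rowAbsDot n A r c) (dgetD s c)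

/-- Per-row bound from the test: `|A ξ|_c ≤ s_c` on the `r`-box. [folklore] -/
theorem mulVec_le_of_checkRowsLe {n : ℕ} {A : Array (Array Dyad)} {r s : Array Dyad} (h : checkRowsLe n A r s = true) :
    ∀ ξ : Fin n → ℝ, (∀ c, |ξ c| ≤ dvec (n := n) r c) → ∀ c, |(dmat (n := n) A).mulVec ξ c| ≤ dvec (n := n) s c := by
  intro ξ hξ c
  simp only [checkRowsLe, List.all_eq_true, List.mem_range, Dyad.ble_iff] at h
  have hrow := h c c.isLt
  rw [toReal_rowAbsDot] at hrow
  have h1 : |(dmat (n := n) A).mulVec ξ c| ≤ ∑ d : Fin n, |(dmgetD A c d).toReal| * dvec (n := n) r d := by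
    simp only [Matrix.mulVec, dotProduct, dmat]
    refine (Finset.abs_sum_le_sum_abs _ _).trans (Finset.sum_le_sum fun d _ => ?_)
    rw [abs_mul]
    exact mul_le_mul_of_nonneg_left (hξ d) (abs_nonneg _)
  refine h1.trans (le_of_eq_of_le ?_ hrow)
  simp only [dvec]
  exact (Fin.sum_univ_eq_sum_range (fun d => |(dmgetD A c d).toReal| * (dgetD r d).toReal) n)

/-- **The hull-radius test**: `ρ_c + E_c ≤ ρ_s` for every `c < n`. [folklore] -/
def checkHull (n : ℕ) (ρD ED : Array Dyad) (ρs : Dyad) : Bool :=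
  (List.range n).all fun c => Dyad.ble (Dyad.add (dgetD ρD c) (dgetD ED c)) ρs

/-- The hull radii from the test. [folklore] -/
theorem hull_le_of_checkHull {n : ℕ} {ρD ED : Array Dyad} {ρs : Dyad} (h : checkHull n ρD ED ρs = true) :
    ∀ c : Fin n, dvec (n := n) ρD c + dvec (n := n) ED c ≤ ρs.toReal := by
  intro c
  simp only [checkHull, List.all_eq_true, List.mem_range, Dyad.ble_iff, Dyad.toReal_add] at h
  exact h c c.isLt

/-- **The C9v guard test**: `0 ≤ h` and `b (mC + ρs) h < 1` exactly. [folklore] -/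
def checkGuardV (b mC ρs h : ℚ) : Bool := decide (0 ≤ h) && decide (b * (mC + ρs) * h < 1)

/-- C9v from the test. [folklore] -/
theorem guardV_of_check {b mC ρs h : ℚ} (hc : checkGuardV b mC ρs h = true) :
    (0 : ℝ) ≤ (h : ℝ) ∧ (b : ℝ) * ((mC : ℝ) + (ρs : ℝ)) * (h : ℝ) < 1 := by
  simp only [checkGuardV, Bool.and_eq_true, decide_eq_true_eq] at hc
  obtain ⟨h1, h2⟩ := hc
  refine ⟨by exact_mod_cast h1, ?_⟩
  have : ((b * (mC + ρs) * h : ℚ) : ℝ) < 1 := by exact_mod_cast h2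
  push_cast at this
  exact this

/-! ### The hull box and the remainder box -/

/-- The node hull box `[x_c − (ρ_c + E_c), x_c + (ρ_c + E_c)]` (exact dyadic endpoints). [folklore] -/
def hullBoxA (n : ℕ) (xD ρD ED : Array Dyad) : Array IntervalD :=
  Array.ofFn fun c : Fin n =>
    (⟨Dyad.sub (dgetD xD c) (Dyad.add (dgetD ρD c) (dgetD ED c)), Dyad.add (dgetD xD c) (Dyad.add (dgetD ρD c) (dgetD ED c))⟩ :
      IntervalD)

/-- A point of the hull lies in the hull box. [folklore] -/
theorem mem_hullBoxA {n : ℕ} (xD ρD ED : Array Dyad) {z : Fin n → ℝ}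
    (hz : ∀ d, |z d - dvec (n := n) xD d| ≤ dvec (n := n) ρD d + dvec (n := n) ED d) :
    ∀ c < n, IntervalD.mem (rdN z c) (IntervalD.aget (hullBoxA n xD ρD ED) c) := by
  intro c hc
  unfold hullBoxA
  rw [IntervalD.aget_ofFn _ hc, rdN_of_lt _ hc]
  have h := abs_le.mp (hz ⟨c, hc⟩)
  simp only [dvec] at h
  constructor
  · simp only [Dyad.toReal_sub, Dyad.toReal_add]; linarith [h.1]
  · simp only [Dyad.toReal_add]; linarith [h.2]

/-- The symmetric box `[−E_c, E_c]`. [folklore] -/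
def symBoxA (n : ℕ) (ED : Array Dyad) : Array IntervalD :=
  Array.ofFn fun c : Fin n => (⟨Dyad.neg (dgetD ED c), dgetD ED c⟩ : IntervalD)

/-- A vector bounded by `E` lies in the symmetric box. [folklore] -/
theorem mem_symBoxA {n : ℕ} (ED : Array Dyad) {e : Fin n → ℝ} (he : ∀ c, |e c| ≤ dvec (n := n) ED c) :
    ∀ c < n, IntervalD.mem (rdN e c) (IntervalD.aget (symBoxA n ED) c) := by
  intro c hc
  unfold symBoxA
  rw [IntervalD.aget_ofFn _ hc, rdN_of_lt _ hc]
  have h := abs_le.mp (he ⟨c, hc⟩)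
  simp only [dvec] at h
  exact ⟨by simp only [Dyad.toReal_neg]; exact h.1, h.2⟩

/-! ### C4v: the centre defect, computed -/

/-- The per-component centre defect `dP_c = mag(P_c ⊖ x'_c)` for an enclosure table `P` of the Taylor polynomial. [folklore] -/
def dPArr (n prec : ℕ) (P : Array IntervalD) (x' : Array Dyad) : Array Dyad :=
  Array.ofFn fun c : Fin n => IntervalD.mag (IntervalD.subR prec (IntervalD.aget P c) (IntervalD.ofDyad (dgetD x' c)))

variable {m : ℕ} {Kb Ka : ℤ} {ω : Fin m → ℤ → ℝ} {ε₀ : ℝ} {α : Fin m → Fin m → Fin m → ℤ × ℤ × ℤ → ℝ}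
  {shifts : List (ℤ × ℤ × ℤ)} {prec : ℕ} {coefB : Fin m → ℤ → Fin m → Fin m → ℤ × ℤ × ℤ → IntervalD}

/-- **C4v**: `|TPoly_c(x) − x'_c| ≤ dP_c` for the computed `dPArr` (Horner table of the jets of `x` at `u ∈ H`). [folklore] -/
theorem abs_TPoly_sub_le_dPArr (hKb : 0 ≤ Kb) (hKa : 1 ≤ Ka) (hnd : shifts.Nodup) (hcoef : CoefBoxOK shifts ε₀ α Kb Ka ω coefB)
    (p : ℕ) {X : Array IntervalD} (hX : X.size = m * winLen Kb Ka) {x : Fin (m * winLen Kb Ka) → ℝ}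
    (hx : ∀ c < m * winLen Kb Ka, IntervalD.mem (rdN x c) (IntervalD.aget X c)) {H : IntervalD} {u : ℝ} (hu : IntervalD.mem u H)
    (x' : Array Dyad) :
    ∀ c, |TPoly (PQcN shifts.toFinset ε₀ α Kb Ka ω) p x u c - (dgetD x' c).toReal| ≤
      (dgetD (dPArr (m * winLen Kb Ka) prec (IntervalD.polyLevelsA (m * winLen Kb Ka) prec
        (IntervalD.jetLevelsA (m * winLen Kb Ka) (pqBoxA Kb Ka prec shifts coefB) prec X p) p H) x') c).toReal := by
  intro c
  have h1 := mem_TPoly_polyLevels (prec := prec) hKb hKa hnd hcoef p hX hx hu c c.isLt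
  rw [rdN_of_lt _ c.isLt] at h1
  have h2 := IntervalD.mem_subR prec h1 (IntervalD.mem_ofDyad (dgetD x' c))
  have hsz : (c : ℕ) < (dPArr (m * winLen Kb Ka) prec (IntervalD.polyLevelsA (m * winLen Kb Ka) prec
      (IntervalD.jetLevelsA (m * winLen Kb Ka) (pqBoxA Kb Ka prec shifts coefB) prec X p) p H) x').size := by
    simp [dPArr]
  unfold dgetD
  rw [dif_pos hsz]
  simp only [dPArr, Array.getElem_ofFn]
  exact IntervalD.abs_le_mag h2

/-! ### The remainder-direction bound `NVE`, computed -/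

/-- The per-component magnitudes of an interval column. [folklore] -/
def nveArr (n : ℕ) (VB : Array IntervalD) : Array Dyad := Array.ofFn fun c : Fin n => IntervalD.mag (IntervalD.aget VB c)

/-- Reading `nveArr`. [folklore] -/
theorem dgetD_nveArr {n : ℕ} (VB : Array IntervalD) (c : Fin n) : dgetD (nveArr n VB) c = IntervalD.mag (IntervalD.aget VB c) := by
  have hsz : (c : ℕ) < (nveArr n VB).size := by simp [nveArr]
  unfold dgetD
  rw [dif_pos hsz]
  simp [nveArr, Array.getElem_ofFn]

/-- **The remainder-direction bound**: for every `z` in the hull box and `e` in `[−E, E]`, `|VPoly(z)(e)_c| ≤ NVE_c` where `NVE = nveArr` of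
ONE variational column over the hull box with the direction box `symBoxA E`. [cite: Zgliczynski2002C1Lohner, §3–4 (the variational part); cell certificate format, checker clauses] -/
theorem abs_VPoly_le_nveArr (hKb : 0 ≤ Kb) (hKa : 1 ≤ Ka) (hnd : shifts.Nodup) (hcoef : CoefBoxOK shifts ε₀ α Kb Ka ω coefB) (p : ℕ)
    (xD ρD ED : Array Dyad) {H : IntervalD} {u : ℝ} (hu : IntervalD.mem u H) :
    ∀ z : Fin (m * winLen Kb Ka) → ℝ,
      (∀ d, |z d - dvec (n := m * winLen Kb Ka) xD d| ≤ dvec (n := m * winLen Kb Ka) ρD d + dvec (n := m * winLen Kb Ka) ED d) →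
      ∀ e : Fin (m * winLen Kb Ka) → ℝ, (∀ c, |e c| ≤ dvec (n := m * winLen Kb Ka) ED c) →
      ∀ c, |VPoly (PQcN shifts.toFinset ε₀ α Kb Ka ω) p z e u c| ≤
        (dgetD (nveArr (m * winLen Kb Ka) (IntervalD.polyLevelsA (m * winLen Kb Ka) prec
          (IntervalD.varJetLevelsA (m * winLen Kb Ka) (pqBoxA Kb Ka prec shifts coefB) prec
            (IntervalD.jetLevelsA (m * winLen Kb Ka) (pqBoxA Kb Ka prec shifts coefB) prec
              (hullBoxA (m * winLen Kb Ka) xD ρD ED) p) (symBoxA (m * winLen Kb Ka) ED) p) p H)) c).toReal := by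
  intro z hz e he c
  rw [dgetD_nveArr]
  have hm := mem_VPoly_polyLevels (prec := prec) hKb hKa hnd hcoef p (by simp [hullBoxA]) (by simp [symBoxA])
    (mem_hullBoxA xD ρD ED hz) (mem_symBoxA ED he) hu c c.isLt
  rw [rdN_of_lt _ c.isLt] at hm
  exact IntervalD.abs_le_mag hm

/-! ### The frame enclosure `κ`, computed -/

/-- Entry box `(c, j)` of `Cn·T ⊖ [V C]`. [folklore] -/
def kEntry (prec n : ℕ) (Cn T : Array (Array Dyad)) (Wcols : Array (Array IntervalD)) (c j : ℕ) : IntervalD :=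
  IntervalD.subR prec (ipvEntry prec n Cn (colBoxA n T j) c) (IntervalD.aget (IntervalD.lget Wcols j) c)

/-- The per-row frame-enclosure bounds `κ_c = Σ_j mag(kEntry c j)·r_j`. [folklore] -/
def kappaArr (prec n : ℕ) (Cn T : Array (Array Dyad)) (Wcols : Array (Array IntervalD)) (rD : Array Dyad) : Array Dyad :=
  Array.ofFn fun c : Fin n => rowMagDot n (kEntry prec n Cn T Wcols) rD c

/-- **The frame enclosure**: for every `z` in the hull box and `ξ` in the `r`-box, `|VPoly(z)(C ξ)_c − (Cn T ξ)_c| ≤ κ_c` where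
`κ = kappaArr` against the variational columns `[V C] = vcolsA` over the HULL box — the hypothesis `hκ` of glue XVIII-c / XIX-h.
[cite: Zgliczynski2002C1Lohner, §3–4 (Lohner-type parallelepiped frames: mean-value form); cell certificate format, checker clauses] -/
theorem kappa_of_kappaArr (hKb : 0 ≤ Kb) (hKa : 1 ≤ Ka) (hnd : shifts.Nodup) (hcoef : CoefBoxOK shifts ε₀ α Kb Ka ω coefB) (p : ℕ)
    (xD ρD ED : Array Dyad) {H : IntervalD} {u : ℝ} (hu : IntervalD.mem u H) (C Cn T : Array (Array Dyad)) (rD : Array Dyad) :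
    ∀ z : Fin (m * winLen Kb Ka) → ℝ,
      (∀ d, |z d - dvec (n := m * winLen Kb Ka) xD d| ≤ dvec (n := m * winLen Kb Ka) ρD d + dvec (n := m * winLen Kb Ka) ED d) →
      ∀ ξ : Fin (m * winLen Kb Ka) → ℝ, (∀ c, |ξ c| ≤ dvec (n := m * winLen Kb Ka) rD c) →
      ∀ c, |(VPoly (PQcN shifts.toFinset ε₀ α Kb Ka ω) p z ((dmat (n := m * winLen Kb Ka) C).mulVec ξ) u -
          (dmat (n := m * winLen Kb Ka) Cn).mulVec ((dmat (n := m * winLen Kb Ka) T).mulVec ξ)) c| ≤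
        (dgetD (kappaArr prec (m * winLen Kb Ka) Cn T
          (vcolsA Kb Ka prec shifts coefB p (IntervalD.jetLevelsA (m * winLen Kb Ka) (pqBoxA Kb Ka prec shifts coefB) prec
            (hullBoxA (m * winLen Kb Ka) xD ρD ED) p) H C) rD) c).toReal := by
  intro z hz ξ hξ c
  have hsz : (c : ℕ) < (kappaArr prec (m * winLen Kb Ka) Cn T
      (vcolsA Kb Ka prec shifts coefB p (IntervalD.jetLevelsA (m * winLen Kb Ka) (pqBoxA Kb Ka prec shifts coefB) prec
        (hullBoxA (m * winLen Kb Ka) xD ρD ED) p) H C) rD).size := by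
    simp only [kappaArr, Array.size_ofFn]; exact c.isLt
  unfold dgetD
  rw [dif_pos hsz]
  simp only [kappaArr, Array.getElem_ofFn]
  rw [VPoly_mulVec isLinearMap_PQcN_right isLinearMap_PQcN_left, Matrix.mulVec_mulVec, ← Matrix.sub_mulVec]
  -- as a row of `−(Cn T − W(z))`
  have hrow : ((wMat (PQcN shifts.toFinset ε₀ α Kb Ka ω) p z (dmat (n := m * winLen Kb Ka) C) u -
      dmat (n := m * winLen Kb Ka) Cn * dmat (n := m * winLen Kb Ka) T).mulVec ξ) c =
      -∑ j : Fin (m * winLen Kb Ka), ((dmat (n := m * winLen Kb Ka) Cn * dmat (n := m * winLen Kb Ka) T) c j -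
        wMat (PQcN shifts.toFinset ε₀ α Kb Ka ω) p z (dmat (n := m * winLen Kb Ka) C) u c j) * ξ j := by
    simp only [Matrix.mulVec, dotProduct, Matrix.sub_apply, ← Finset.sum_neg_distrib]
    exact Finset.sum_congr rfl fun j _ => by ring
  rw [hrow, abs_neg]
  refine abs_sum_le_rowMagDot
    (A := fun c j => (dmat (n := m * winLen Kb Ka) Cn * dmat (n := m * winLen Kb Ka) T) c j -
      wMat (PQcN shifts.toFinset ε₀ α Kb Ka ω) p z (dmat (n := m * winLen Kb Ka) C) u c j)
    (B := kEntry prec (m * winLen Kb Ka) Cn T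
      (vcolsA Kb Ka prec shifts coefB p (IntervalD.jetLevelsA (m * winLen Kb Ka) (pqBoxA Kb Ka prec shifts coefB) prec
        (hullBoxA (m * winLen Kb Ka) xD ρD ED) p) H C)) (c := c) (fun j => ?_) hξ
  unfold kEntry
  refine IntervalD.mem_subR prec ?_ (mem_wMat hKb hKa hnd hcoef p (by simp [hullBoxA]) (mem_hullBoxA xD ρD ED hz) hu C c j)
  rw [Matrix.mul_apply]
  refine mem_ipvEntry prec Cn (fun d => ?_) c
  unfold colBoxA
  rw [IntervalD.aget_ofFn _ d.isLt]
  exact IntervalD.mem_ofDyad _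

/-! ### C8v: the per-component E-recursion -/

/-- **The C8v test**: `dP_c + κ_c + NVE_c + remQ p b (mC + ρs) h ≤ E'_c` for every `c < n`, exactly. [folklore] -/
def checkERecV (n p : ℕ) (b mC ρs h : ℚ) (dPA κA nveA E1D : Array Dyad) : Bool :=
  (List.range n).all fun c =>
    decide (dyadToRat (dgetD dPA c) + dyadToRat (dgetD κA c) + dyadToRat (dgetD nveA c) + remQ p b (mC + ρs) h ≤
      dyadToRat (dgetD E1D c))

/-- **C8v FROM THE TEST**: the per-component E-recursion `hE₁` of glue XVIII-c / XIX-h for the cast data. [folklore] -/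
theorem eRecV_of_check {n p : ℕ} {b mC ρs h : ℚ} {dPA κA nveA E1D : Array Dyad} (hc : checkERecV n p b mC ρs h dPA κA nveA E1D = true) :
    ∀ c : Fin n, (dgetD dPA c).toReal + (dgetD κA c).toReal + (dgetD nveA c).toReal +
      ((mC : ℝ) + (ρs : ℝ)) * ((b : ℝ) * ((mC : ℝ) + (ρs : ℝ)) * (h : ℝ)) ^ (p + 1) / (1 - (b : ℝ) * ((mC : ℝ) + (ρs : ℝ)) * (h : ℝ)) ≤
      dvec (n := n) E1D c := by
  intro c
  simp only [checkERecV, List.all_eq_true, List.mem_range, decide_eq_true_eq] at hc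
  have h1 := (Rat.cast_le (K := ℝ)).mpr (hc c c.isLt)
  simp only [Rat.cast_add, cast_dyadToRat, remQ, Rat.cast_div, Rat.cast_mul, Rat.cast_pow, Rat.cast_sub, Rat.cast_one] at h1
  simpa [dvec] using h1

end CertificateGlueOn

end Summit.NavierStokesRegularity.NavierStokesRegularity.Theorems
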